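import Literature.Topology.Algebra.CompactOpenSubgroupTrace
import HarnessLib

/-!
# Monotone traces: compact open subgroups of a closed subgroup are traces of a MONOTONE family of compact open subgroups

Topic `Topology/Algebra`, namespace `Literature.Topology.Algebra`.  THEOREMS ONLY; imports the tree's ★
`CompactOpenSubgroupTrace` (+ Mathlib through it).

★ `exists_isOpen_isCompact_subgroup_comap_eq` ([Deligne1971TravauxShimura] Prop. 1.15 / [Milne2005ShimuraVarieties] Thm. 5.16, the
Chevalley–Platonov–Rapinchuk step): along a closed embedding `φ : G' →* G`, every compact open `K' ≤ φ⁻¹(K₀)` is `φ⁻¹(K)` for SOME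
compact open `K ≤ K₀`.  For a TOWER of levels one needs the choice `K' ↦ K` to be MONOTONE (so that the transition maps of a
`G`-tower restrict to the `G'`-tower; [Deligne1971TravauxShimura] Variante 5.9 / [Milne2005ShimuraVarieties] Thm. 5.16 «an inverse
system of regular maps … compatible»).  This file supplies it:

* `finite_setOf_subgroup_le_le` — between an OPEN subgroup `K'` and a COMPACT subgroup `K₀' ≥ K'` of a topological group there are
  only finitely many subgroups (they are unions of the finitely many cosets of `K'` in `K₀'`);
* `exists_monotone_isOpen_isCompact_subgroup_comap_eq` — **monotone traces**: for a closed embedding `φ : G' →* G` of a topological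
  group into a totally disconnected one, a compact open `K₀ ≤ G` and a compact open `K₀' ≤ φ⁻¹(K₀)`, there is `T : Subgroup G' → Subgroup G`
  which on the open subgroups `K' ≤ K₀'` takes compact open values `≤ K₀` with `φ⁻¹(T K') = K'` and is MONOTONE there.  Construction:
  `T K' := ⨅ {trace K'' | K' ≤ K'' ≤ K₀', K'' open}` — a finite infimum of compact open subgroups, with `φ⁻¹(T K') = ⨅ K'' = K'`.

## References
* [Deligne1971TravauxShimura] P. Deligne, *Travaux de Shimura* (1971), Prop. 1.15 p. 132 and Variante 5.9 p. 157.
* [Milne2005ShimuraVarieties] J. S. Milne, *Introduction to Shimura varieties* (2005/2017), Thm. 5.16 and proof, p. 58.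
* [PlatonovRapinchuk1994] V. Platonov, A. Rapinchuk, *Algebraic Groups and Number Theory* (1994), §3.3.
-/

set_option autoImplicit false

open scoped Pointwise
open scoped _root_.Topology

namespace Literature.Topology.Algebra

section Finite

variable {G : Type*} [Group G] [TopologicalSpace G] [IsTopologicalGroup G]

/-- **Finitely many subgroups between an open subgroup and a compact subgroup containing it.**  If `K' ≤ K₀'` are subgroups of a
topological group with `K'` OPEN and `K₀'` COMPACT, the set of subgroups `H` with `K' ≤ H ≤ K₀'` is finite: `K'` has finite index in
`K₀'` (the quotient of a compact group by an open subgroup is finite, Mathlib `Subgroup.quotient_finite_of_isOpen`) and such an `H` is the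
union of the cosets of `K'` it contains. [cite: PlatonovRapinchuk1994, §3.3] -/
theorem finite_setOf_subgroup_le_le (K' K₀' : Subgroup G) (hK'o : IsOpen (K' : Set G)) (hK₀'c : IsCompact (K₀' : Set G)) :
    {H : Subgroup G | K' ≤ H ∧ H ≤ K₀'}.Finite := by
  haveI : CompactSpace K₀' := isCompact_iff_compactSpace.mp hK₀'c
  -- `K'` seen inside the compact group `K₀'`
  set K'' : Subgroup K₀' := K'.subgroupOf K₀' with hK''
  have hK''o : IsOpen (K'' : Set K₀') := by
    have : (K'' : Set K₀') = (Subtype.val : K₀' → G) ⁻¹' (K' : Set G) := rfl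
    rw [this]
    exact hK'o.preimage continuous_subtype_val
  haveI : Finite (K₀' ⧸ K'') := Subgroup.quotient_finite_of_isOpen K'' hK''o
  -- the map `H ↦ image of H in K₀'/K''` is injective on our set
  let f : Subgroup G → Set (K₀' ⧸ K'') := fun H =>
    (QuotientGroup.mk : K₀' → K₀' ⧸ K'') '' ((Subtype.val : K₀' → G) ⁻¹' (H : Set G))
  refine Set.Finite.of_finite_image (f := f) (Set.toFinite _) ?_
  -- symmetric inclusion argument
  have key : ∀ {A B : Subgroup G}, K' ≤ A → A ≤ K₀' → K' ≤ B → f A = f B → A ≤ B := by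
    intro A B _ hAK hKB hAB x hx
    have hxq : (QuotientGroup.mk (⟨x, hAK hx⟩ : K₀') : K₀' ⧸ K'') ∈ f A := ⟨⟨x, hAK hx⟩, hx, rfl⟩
    rw [hAB] at hxq
    obtain ⟨y, hy, hyx⟩ := hxq
    have hrel : y⁻¹ * ⟨x, hAK hx⟩ ∈ K'' := QuotientGroup.eq.mp hyx
    have hrel' : (y : G)⁻¹ * x ∈ K' := by
      rw [hK'', Subgroup.mem_subgroupOf] at hrel
      simpa using hrel
    have : (y : G) * ((y : G)⁻¹ * x) ∈ B := B.mul_mem hy (hKB hrel')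
    simpa using this
  intro H₁ hH₁ H₂ hH₂ hf
  simp only [Set.mem_setOf_eq] at hH₁ hH₂
  exact le_antisymm (key hH₁.1 hH₁.2 hH₂.1 hf) (key hH₂.1 hH₂.2 hH₁.1 hf.symm)

end Finite

section Monotone

variable {G : Type*} [Group G] [TopologicalSpace G] [IsTopologicalGroup G] [TotallyDisconnectedSpace G]
variable {G' : Type*} [Group G'] [TopologicalSpace G'] [IsTopologicalGroup G']

/-- **Monotone traces along a closed embedding** ([Deligne1971TravauxShimura] Prop. 1.15 + Variante 5.9; [Milne2005ShimuraVarieties]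
Thm. 5.16: «for any compact open `K'` of `G'(𝔸_f)` there is a compact open `K` of `G(𝔸_f)` with `K ∩ G'(𝔸_f) = K'`», chosen compatibly
along the inverse system).  Let `φ : G' →* G` be a closed embedding of topological groups, `G` totally disconnected, `K₀ ≤ G` compact
open and `K₀' ≤ φ⁻¹(K₀)` a compact open subgroup of `G'`.  Then there is `T : Subgroup G' → Subgroup G` such that for every OPEN
subgroup `K' ≤ K₀'`: `T K'` is compact open, `T K' ≤ K₀` and `φ⁻¹(T K') = K'`; and `T` is MONOTONE on these subgroups.
Construction: `T K' := ⨅ {trace K'' : K' ≤ K'' ≤ K₀', K'' open}` with `trace` from ★ `exists_isOpen_isCompact_subgroup_comap_eq` — a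
finite infimum (`finite_setOf_subgroup_le_le`).
[cite: Milne2005ShimuraVarieties, Thm. 5.16 and proof p. 58] [cite: Deligne1971TravauxShimura, Prop. 1.15 p. 132 and Variante 5.9 p. 157]
[cite: PlatonovRapinchuk1994, §3.3] -/
theorem exists_monotone_isOpen_isCompact_subgroup_comap_eq (φ : G' →* G) (hφ : Topology.IsClosedEmbedding φ)
    (K₀ : Subgroup G) (hK₀o : IsOpen (K₀ : Set G)) (hK₀c : IsCompact (K₀ : Set G))
    (K₀' : Subgroup G') (hK₀'c : IsCompact (K₀' : Set G'))
    (hle : K₀' ≤ K₀.comap φ) :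
    ∃ T : Subgroup G' → Subgroup G,
      (∀ K' : Subgroup G', IsOpen (K' : Set G') → K' ≤ K₀' →
          IsOpen (T K' : Set G) ∧ IsCompact (T K' : Set G) ∧ T K' ≤ K₀ ∧ (T K').comap φ = K') ∧
      ∀ K₁ K₂ : Subgroup G', K₁ ≤ K₂ → T K₁ ≤ T K₂ := by
  -- the (non-monotone) trace of an open subgroup `K'' ≤ K₀'`
  have htr : ∀ K'' : Subgroup G', IsOpen (K'' : Set G') → K'' ≤ K₀' →
      ∃ K : Subgroup G, IsOpen (K : Set G) ∧ IsCompact (K : Set G) ∧ K ≤ K₀ ∧ K.comap φ = K'' := by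
    intro K'' hKo hKle
    have hKc : IsCompact (K'' : Set G') :=
      hK₀'c.of_isClosed_subset (Subgroup.isClosed_of_isOpen K'' hKo) (fun x hx => hKle hx)
    exact exists_isOpen_isCompact_subgroup_comap_eq φ hφ K₀ hK₀o hK₀c K'' hKo hKc (hKle.trans hle)
  classical
  -- a trace function on all subgroups (junk `⊤` outside the open subgroups `≤ K₀'`)
  let tr : Subgroup G' → Subgroup G := fun K'' =>
    if h : IsOpen (K'' : Set G') ∧ K'' ≤ K₀' then (htr K'' h.1 h.2).choose else ⊤
  have htr_spec : ∀ K'' : Subgroup G', IsOpen (K'' : Set G') → K'' ≤ K₀' →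
      IsOpen (tr K'' : Set G) ∧ IsCompact (tr K'' : Set G) ∧ tr K'' ≤ K₀ ∧ (tr K'').comap φ = K'' := by
    intro K'' hKo hKle
    have h : IsOpen (K'' : Set G') ∧ K'' ≤ K₀' := ⟨hKo, hKle⟩
    simp only [tr, dif_pos h]
    exact (htr K'' hKo hKle).choose_spec
  -- the index sets and the monotone trace
  let S : Subgroup G' → Set (Subgroup G') := fun K' => {K'' | K' ≤ K'' ∧ K'' ≤ K₀' ∧ IsOpen (K'' : Set G')}
  let T : Subgroup G' → Subgroup G := fun K' => ⨅ K'' ∈ S K', tr K''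
  have hSfin : ∀ K' : Subgroup G', IsOpen (K' : Set G') → (S K').Finite := by
    intro K' hK'o
    exact (finite_setOf_subgroup_le_le K' K₀' hK'o hK₀'c).subset (fun K'' h => ⟨h.1, h.2.1⟩)
  have hSmem : ∀ K' : Subgroup G', IsOpen (K' : Set G') → K' ≤ K₀' → K' ∈ S K' :=
    fun K' hK'o hK'le => ⟨le_rfl, hK'le, hK'o⟩
  refine ⟨T, fun K' hK'o hK'le => ?_, fun K₁ K₂ h12 => ?_⟩
  · have hfin := hSfin K' hK'o
    have hmem := hSmem K' hK'o hK'le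
    -- `T K' ≤ tr K' ≤ K₀`
    have hTle : T K' ≤ tr K' := biInf_le _ hmem
    have hTK₀ : T K' ≤ K₀ := hTle.trans (htr_spec K' hK'o hK'le).2.2.1
    -- open: a finite intersection of open subgroups
    have hTo : IsOpen (T K' : Set G) := by
      have hcoe : (T K' : Set G) = ⋂ K'' ∈ S K', (tr K'' : Set G) := by
        simp only [T, Subgroup.coe_iInf]
      rw [hcoe]
      exact hfin.isOpen_biInter fun K'' hK'' => (htr_spec K'' hK''.2.2 hK''.2.1).1
    have hTc : IsCompact (T K' : Set G) :=
      hK₀c.of_isClosed_subset (Subgroup.isClosed_of_isOpen _ hTo) (fun x hx => hTK₀ hx)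
    refine ⟨hTo, hTc, hTK₀, le_antisymm ?_ ?_⟩
    · -- `φ⁻¹(T K') ≤ φ⁻¹(tr K') = K'`
      intro x hx
      have hx' : x ∈ (tr K').comap φ := hTle hx
      rwa [(htr_spec K' hK'o hK'le).2.2.2] at hx'
    · -- `K' ≤ φ⁻¹(tr K'')` for every index `K'' ≥ K'`
      intro x hx
      rw [Subgroup.mem_comap]
      simp only [T, Subgroup.mem_iInf]
      intro K'' hK''
      have hx'' : x ∈ (tr K'').comap φ := by
        rw [(htr_spec K'' hK''.2.2 hK''.2.1).2.2.2]
        exact hK''.1 hx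
      exact hx''
  · -- monotone: larger `K'` has fewer indices
    have hsub : S K₂ ⊆ S K₁ := fun K'' h => ⟨h12.trans h.1, h.2.1, h.2.2⟩
    exact biInf_mono hsub

end Monotone

end Literature.Topology.Algebra
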